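import Summits.BirchSwinnertonDyer.Rank1Residual.Additive.QuadraticBranchMazurTateLimit
import Summits.BirchSwinnertonDyer.Rank1Residual.Additive.QuadraticBranchCharacterEvaluation
import Summits.BirchSwinnertonDyer.Rank1Residual.Additive.QuadraticBranchSignedMainConjecture
import HarnessLib

/-!
# EXISTENCE of Kobayashi's PLUS `p`-adic `L`-function `L_p⁺(V, η, X)` on the quadratic branch
# `η = ω^{(p−1)/2}` (Kobayashi 2003, Thm. 3.2 with (3.4), (3.6)): `∃ L, IsQuadraticBranchPlusLFunction f p ϖ L`
# — the `Lη` quantified by (C1_η) `QuadraticBranchPlusMainConjectureAt` (even levels; proofs only; file 6)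

HONEST FRAMING (cell `bsd-potss`, run/shared/lean/pub/bsd-potss/, FULL-BSD rank ≤ 1 programme
tranche 1b, human ruling D-0036; seat `bsd-potss-ctrl` = "signed control along the quadratic branch"):
the programme's target of record is FULL BSD for every analytic-rank ≤ 1 curve over `ℚ`; this seat's
object is the quadratic (`η = ω^{(p−1)/2}`) branch of Kobayashi's signed theory for the good
`a_p = 0` twin `V` of an additive potentially supersingular curve `W = V ⊗ η` (classes Gss2 / O5 `e = 2`,
O10-PS). THIS FILE: THEOREMS ONLY (no definition, no `sorry`); NOTHING about `BSD(W, p)`, (C1_η),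
(C2_η-GZ) or (C3_η) of any pair is claimed or moved; no named Literature fact is introduced; axioms
standard. (C1_η) quantifies over ALL `Lη` with `IsQuadraticBranchPlusLFunction f p ϖ Lη`; this file
shows such `Lη` EXIST (so the typed conjecture is not vacuous and its `DF.charIdeal = D.charIdeal · (Lη)`
is a genuine constraint); it says nothing about the conjecture itself.

## Contents (the even-level twin of `QuadraticBranchMinusLFunctionExistence.lean`)

* `cyclotomicOmegaMinus_dvd_quadraticBranchMazurTateElement`: `ω⁻_{2m} ∣ θ_{2m}(f, η)` (trivial zeros at
  the roots of unity of ODD order = Kobayashi's `∏_{odd k ≤ n} Φ_k(ζ)^{−1}` in (3.4)).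
* `X_mul_cyclotomicOmegaPlus_dvd_sub_quadraticBranch`: compatibility of `(−1)^{m+1} θ_{2m}(η)/ω⁻_{2m}`
  modulo `T ω⁺_{2m}`.
* `exists_isCongrModOmega_quadraticBranch_even`: `M ∈ Λ` with `θ_{2m}(η) ≡ (−1)^{m+1} ω⁻_{2m} M (mod ω_{2m})`.
* `exists_isQuadraticBranchPlusLFunction`, `…_of_isNewformOf`: for `p` odd, `a_p = 0`, `p ∤ N`, any
  `p`-integral `ϖ`: `∃ L, IsQuadraticBranchPlusLFunction f p ϖ L` (`L = ϖ·M`, `u = 1`; at `n = 0`,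
  `ψ = η`, `ζ = 1`: `L(0) = −ϖ ∑_{a mod p} η(a)[a/p]^δ_f`, Kobayashi's (3.6) in the tree's currency).

References: [Kobayashi2003] Thm. 3.2, (3.4), (3.6) (p. 7); [Pollack2003] Thm. 5.6, Lemma 4.7, Prop. 6.18;
[MazurTateTeitelbaum1986Invent] §I.10 (10.2), §I.13.
-/

noncomputable section

open scoped Classical MatrixGroups ModularForm

open CongruenceSubgroup Polynomial Literature.NumberTheory.EllipticCurves
  Literature.NumberTheory.EllipticCurves.ModularForms

namespace Summit.BirchSwinnertonDyer.Rank1Residual.Additive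

/-! ## §10 The PLUS function on the quadratic branch (even levels): `∃ L, IsQuadraticBranchPlusLFunction f p ϖ L` -/

section PlusBranch

variable {N : ℕ} [NeZero N] {f : CuspForm (Gamma0 N) 2} {p : ℕ} [hp : Fact p.Prime]

/-- **`ω⁻_{2m} ∣ θ_{2m}(η)` in `ℚ[T]`** (`a_p = 0`): induction from the three-term relation at the
even levels (`ω⁻_0 = 1`, `ω⁻_{2m+2} = ω⁻_{2m} Φ_{p^{2m+1}}(1+T)`) — the trivial zeros at the roots of
unity of ODD order, Kobayashi's `∏_{odd k ≤ n} Φ_k(ζ)^{−1}` of (3.4). Port of the tree's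
`cyclotomicOmegaMinus_dvd_mazurTateElement`. [cite: Kobayashi2003, (3.4) (p. 7)] [cite: Pollack2003, Prop. 6.18 (proof)] -/
theorem cyclotomicOmegaMinus_dvd_quadraticBranchMazurTateElement (hf0 : IsNewform0 f)
    (hQ : coeffField f = ⊥) (hpN : ¬ p ∣ N) (hap : cuspCoeff f p = ((0 : ℤ) : ℂ)) (m : ℕ) :
    (cyclotomicOmegaMinus p (2 * m)).map (Int.castRingHom ℚ) ∣
      quadraticBranchMazurTateElement p f (2 * m) := by
  induction m with
  | zero => simp
  | succ m ih =>
    obtain ⟨C, hC⟩ := cyclotomicOmega_dvd_quadraticBranchMazurTateElement_add hf0 hQ hpN hap (2 * m)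
    have h : quadraticBranchMazurTateElement p f (2 * (m + 1)) =
        (cyclotomicOmega p (2 * m + 1)).map (Int.castRingHom ℚ) * C -
          ((cyclotomic (p ^ (2 * m + 1)) ℤ).comp (X + 1)).map (Int.castRingHom ℚ) *
            quadraticBranchMazurTateElement p f (2 * m) := by
      rw [show 2 * (m + 1) = 2 * m + 2 by ring, ← hC, add_sub_cancel_right]
    rw [h, show 2 * (m + 1) = 2 * m + 2 by ring, cyclotomicOmegaMinus_two_mul_add_two,
      Polynomial.map_mul]
    refine dvd_sub (Dvd.dvd.mul_right ?_ _) ?_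
    · rw [← Polynomial.map_mul, ← cyclotomicOmegaMinus_two_mul_add_two,
        ← cyclotomicOmegaMinus_two_mul_add_one, ← X_mul_cyclotomicOmegaPlus_mul_cyclotomicOmegaMinus]
      exact Polynomial.map_dvd _ (dvd_mul_left _ _)
    · rw [mul_comm (((cyclotomic (p ^ (2 * m + 1)) ℤ).comp (X + 1)).map (Int.castRingHom ℚ))]
      exact mul_dvd_mul ih dvd_rfl

/-- **Compatibility of the even-level quotients** `ℓ_m = θ_{2m}(η)/ω⁻_{2m}`:
`T ω⁺_{2m} ∣ (−1)^{m+2} ℓ_{m+1} − (−1)^{m+1} ℓ_m`. Port of the tree's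
`X_mul_cyclotomicOmegaPlus_dvd_sub_minus`. [cite: Pollack2003, Prop. 6.18 (proof)] -/
theorem X_mul_cyclotomicOmegaPlus_dvd_sub_quadraticBranch (hf0 : IsNewform0 f)
    (hQ : coeffField f = ⊥) (hpN : ¬ p ∣ N) (hap : cuspCoeff f p = ((0 : ℤ) : ℂ)) (m : ℕ) :
    X * (cyclotomicOmegaPlus p (2 * m)).map (Int.castRingHom ℚ) ∣
      (-1) ^ (m + 2) * (quadraticBranchMazurTateElement p f (2 * (m + 1)) /ₘ
          (cyclotomicOmegaMinus p (2 * (m + 1))).map (Int.castRingHom ℚ)) -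
        (-1) ^ (m + 1) * (quadraticBranchMazurTateElement p f (2 * m) /ₘ
          (cyclotomicOmegaMinus p (2 * m)).map (Int.castRingHom ℚ)) := by
  obtain ⟨C, hC⟩ := cyclotomicOmega_dvd_quadraticBranchMazurTateElement_add hf0 hQ hpN hap (2 * m)
  set ξ : ℚ[X] := ((cyclotomic (p ^ (2 * m + 1)) ℤ).comp (X + 1)).map (Int.castRingHom ℚ) with hξ
  set ωm : ℚ[X] := (cyclotomicOmegaMinus p (2 * m)).map (Int.castRingHom ℚ) with hωm
  set ωp : ℚ[X] := (cyclotomicOmegaPlus p (2 * m)).map (Int.castRingHom ℚ) with hωp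
  set ℓ₀ := quadraticBranchMazurTateElement p f (2 * m) /ₘ ωm with hℓ₀
  set ℓ₁ := quadraticBranchMazurTateElement p f (2 * (m + 1)) /ₘ
    (cyclotomicOmegaMinus p (2 * (m + 1))).map (Int.castRingHom ℚ) with hℓ₁
  have hmon0 : ωm.Monic := (monic_cyclotomicOmegaMinus p (2 * m)).map _
  have hmon1 : ((cyclotomicOmegaMinus p (2 * (m + 1))).map (Int.castRingHom ℚ)).Monic :=
    (monic_cyclotomicOmegaMinus p _).map _
  have hθ0 : quadraticBranchMazurTateElement p f (2 * m) = ωm * ℓ₀ :=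
    (mul_divByMonic_eq_of_monic_of_dvd hmon0
      (cyclotomicOmegaMinus_dvd_quadraticBranchMazurTateElement hf0 hQ hpN hap m)).symm
  have hθ1 : quadraticBranchMazurTateElement p f (2 * (m + 1)) = ωm * ξ * ℓ₁ := by
    have h := (mul_divByMonic_eq_of_monic_of_dvd hmon1
      (cyclotomicOmegaMinus_dvd_quadraticBranchMazurTateElement hf0 hQ hpN hap (m + 1))).symm
    rw [h, ← hℓ₁, show 2 * (m + 1) = 2 * m + 2 by ring, cyclotomicOmegaMinus_two_mul_add_two,
      Polynomial.map_mul]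
  have hΩ : (cyclotomicOmega p (2 * m + 1)).map (Int.castRingHom ℚ) = X * ωp * (ωm * ξ) := by
    rw [← X_mul_cyclotomicOmegaPlus_mul_cyclotomicOmegaMinus, cyclotomicOmegaPlus_two_mul_add_one,
      cyclotomicOmegaMinus_two_mul_add_one, cyclotomicOmegaMinus_two_mul_add_two,
      Polynomial.map_mul, Polynomial.map_mul, Polynomial.map_mul, Polynomial.map_X]
  have hne : ωm * ξ ≠ 0 :=
    (hmon0.mul ((monic_cyclotomic_comp_X_add_one (p ^ (2 * m + 1))).map _)).ne_zero
  have hkey : ℓ₁ + ℓ₀ = X * ωp * C := by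
    rw [show 2 * m + 2 = 2 * (m + 1) by ring, hθ1, hθ0, hΩ] at hC
    have h2 : ωm * ξ * (ℓ₁ + ℓ₀) = ωm * ξ * (X * ωp * C) := by linear_combination hC
    exact mul_left_cancel₀ hne h2
  refine ⟨(-1) ^ (m + 2) * C, ?_⟩
  have h3 : ((-1 : ℚ[X]) ^ (m + 1)) = -((-1) ^ (m + 2)) := by ring
  rw [h3]
  linear_combination ((-1 : ℚ[X]) ^ (m + 2)) * hkey

omit [NeZero N] in
/-- Monic descent `ℚ_p[T] → ℤ_p[T]` (local copy). [folklore] -/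
private theorem dvd_of_map_dvd_map'' {D P : ℤ_[p][X]} (hD : D.Monic)
    (h : D.map (algebraMap ℤ_[p] ℚ_[p]) ∣ P.map (algebraMap ℤ_[p] ℚ_[p])) : D ∣ P := by
  rw [← modByMonic_eq_zero_iff_dvd hD]
  apply Polynomial.map_injective (algebraMap ℤ_[p] ℚ_[p]) (IsFractionRing.injective ℤ_[p] ℚ_[p])
  rw [Polynomial.map_modByMonic _ hD, Polynomial.map_zero]
  exact (modByMonic_eq_zero_iff_dvd (hD.map _)).mpr h

omit [NeZero N] in
/-- The two routes `ℤ[T] → ℚ_p[T]` agree (local copy). [folklore] -/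
private theorem map_map_int_eq'' (q : ℤ[X]) :
    (q.map (Int.castRingHom ℚ)).map (algebraMap ℚ ℚ_[p]) =
      (q.map (Int.castRingHom ℤ_[p])).map (algebraMap ℤ_[p] ℚ_[p]) := by
  rw [Polynomial.map_map, Polynomial.map_map,
    RingHom.ext_int ((algebraMap ℚ ℚ_[p]).comp (Int.castRingHom ℚ))
      ((algebraMap ℤ_[p] ℚ_[p]).comp (Int.castRingHom ℤ_[p]))]

omit [NeZero N] in
/-- Descent of a divisibility from `ℚ[T]` to `ℤ_p[T]` (local copy). [folklore] -/
private theorem map_dvd_of_dvd'' {D : ℤ[X]} (hD : D.Monic) {P : ℚ[X]} {Θ : ℤ_[p][X]}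
    (hΘ : Θ.map (algebraMap ℤ_[p] ℚ_[p]) = P.map (algebraMap ℚ ℚ_[p]))
    (h : D.map (Int.castRingHom ℚ) ∣ P) : D.map (Int.castRingHom ℤ_[p]) ∣ Θ := by
  refine dvd_of_map_dvd_map'' (hD.map _) ?_
  rw [← map_map_int_eq'', hΘ]
  exact Polynomial.map_dvd _ h

omit [NeZero N] in
/-- The constant term of `Φ_{p^{k+1}}(1+T)` is `p` (local copy). [folklore] -/
private theorem dvd_coeff_zero_cyclotomic_comp'' (k : ℕ) :
    (p : ℤ_[p]) ∣ (((cyclotomic (p ^ (k + 1)) ℤ).comp (X + 1)).map (Int.castRingHom ℤ_[p])).coeff 0 := by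
  rw [coeff_map, coeff_zero_eq_eval_zero, eval_comp, eval_add, eval_X, eval_one, zero_add,
    eval_one_cyclotomic_prime_pow, map_natCast]

omit [NeZero N] [Fact p.Prime] in
/-- The algebraic identity behind the congruence (local copy). [folklore] -/
private theorem sub_mul_eq_of_identities'' {R : Type*} [CommRing R] {Θ Ωm Ωp B q g L Q Ω σ : R}
    (hσ : σ * σ = 1) (hΘ : Θ = Ωm * q) (hg : g = σ * q) (hL : L - g = B * Ωp * Q)
    (hΩ : Ω = B * Ωp * Ωm) : Θ - σ * Ωm * L = Ω * -(σ * Q) := by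
  have hL' : L = g + B * Ωp * Q := by rw [← hL]; ring
  rw [hL', hg, hΘ, hΩ]
  linear_combination (-(Ωm * q)) * hσ

/-- **Existence at the EVEN levels**: `M ∈ Λ` with `θ_{2m}(η) ≡ (−1)^{m+1} ω⁻_{2m} M (mod ω_{2m} Λ)` for
every `m` — `M = lim_m (−1)^{m+1} θ_{2m}(η)/ω⁻_{2m}` in `Λ = lim Λ/(T ω⁺_{2m})`; this `M` is
Kobayashi's `L_p⁺(E, η, X)` up to the period normalisation (Thm. 3.2 with (3.4)). Port of the tree's
`exists_isCongrModOmega_even`. [cite: Kobayashi2003, Thm. 3.2 and (3.4) (p. 7)] [cite: Pollack2003, Prop. 6.18] -/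
theorem exists_isCongrModOmega_quadraticBranch_even (hp2 : p ≠ 2) (hf0 : IsNewform0 f)
    (hQ : coeffField f = ⊥) (hpN : ¬ p ∣ N) (hap : cuspCoeff f p = ((0 : ℤ) : ℂ)) :
    ∃ L : IwasawaAlgebra p, ∀ m : ℕ,
      IsCongrModOmega p (2 * m) (quadraticBranchMazurTateElement p f (2 * m))
        ((-1) ^ (m + 1) * cyclotomicOmegaMinus p (2 * m)) L := by
  classical
  choose Θ hΘ using fun n ↦ exists_map_eq_map_quadraticBranchMazurTateElement hp2 hf0 hQ hpN hap n
  set Ωm : ℕ → ℤ_[p][X] := fun k ↦ (cyclotomicOmegaMinus p k).map (Int.castRingHom ℤ_[p])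
    with hΩm
  set Ωp : ℕ → ℤ_[p][X] := fun k ↦ (cyclotomicOmegaPlus p k).map (Int.castRingHom ℤ_[p])
    with hΩp
  have hmon : ∀ k, (Ωm k).Monic := fun k ↦ (monic_cyclotomicOmegaMinus p k).map _
  have hdiv : ∀ m, Ωm (2 * m) ∣ Θ (2 * m) := fun m ↦
    map_dvd_of_dvd'' (monic_cyclotomicOmegaMinus p _) (hΘ _)
      (cyclotomicOmegaMinus_dvd_quadraticBranchMazurTateElement hf0 hQ hpN hap m)
  set g : ℕ → ℤ_[p][X] := fun m ↦ (-1) ^ (m + 1) * (Θ (2 * m) /ₘ Ωm (2 * m)) with hg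
  have hgmap : ∀ m, (g m).map (algebraMap ℤ_[p] ℚ_[p]) =
      ((-1) ^ (m + 1) * (quadraticBranchMazurTateElement p f (2 * m) /ₘ
        (cyclotomicOmegaMinus p (2 * m)).map (Int.castRingHom ℚ))).map (algebraMap ℚ ℚ_[p]) := by
    intro m
    rw [hg]
    dsimp only
    rw [Polynomial.map_mul, Polynomial.map_mul, Polynomial.map_pow, Polynomial.map_pow,
      Polynomial.map_neg, Polynomial.map_neg, Polynomial.map_one, Polynomial.map_one,
      Polynomial.map_divByMonic _ (hmon _), Polynomial.map_divByMonic _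
        ((monic_cyclotomicOmegaMinus p _).map _), hΘ, map_map_int_eq'']
  have hcompat : ∀ m, X * Ωp (2 * m) ∣ g (m + 1) - g m := by
    intro m
    have hD : (X * cyclotomicOmegaPlus p (2 * m)).Monic := monic_X.mul (monic_cyclotomicOmegaPlus p _)
    have h1 : (X * cyclotomicOmegaPlus p (2 * m)).map (Int.castRingHom ℤ_[p]) = X * Ωp (2 * m) := by
      rw [Polynomial.map_mul, Polynomial.map_X]
    rw [← h1]
    refine dvd_of_map_dvd_map'' (hD.map _) ?_
    rw [← map_map_int_eq'', Polynomial.map_sub, hgmap, hgmap, ← Polynomial.map_sub,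
      Polynomial.map_mul, Polynomial.map_X]
    exact Polynomial.map_dvd _ (X_mul_cyclotomicOmegaPlus_dvd_sub_quadraticBranch hf0 hQ hpN hap m)
  choose s hs using hcompat
  set ξ : ℕ → ℤ_[p][X] := fun i ↦
    ((cyclotomic (p ^ (2 * i + 2)) ℤ).comp (X + 1)).map (Int.castRingHom ℤ_[p]) with hξ
  have hξ0 : ∀ i, (p : ℤ_[p]) ∣ (ξ i).coeff 0 := fun i ↦ by
    rw [hξ]
    dsimp only
    rw [show 2 * i + 2 = (2 * i + 1) + 1 by ring]
    exact dvd_coeff_zero_cyclotomic_comp'' _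
  have hΩpξ : ∀ m, Ωp (2 * m) = ∏ i ∈ Finset.range m, ξ i := fun m ↦ by
    rw [hΩp, hξ]
    dsimp only
    rw [cyclotomicOmegaPlus_two_mul_eq_prod, Polynomial.map_prod]
  obtain ⟨L, hL⟩ := exists_powerSeries_sub_eq_mul X ξ hξ0 g s fun M ↦ by rw [← hΩpξ, hs]
  refine ⟨L, fun m ↦ ?_⟩
  obtain ⟨Q, hLQ⟩ := hL m
  rw [← hΩpξ] at hLQ
  refine ⟨0, -((-1) ^ (m + 1) * Q), ?_⟩
  have hθ : (((quadraticBranchMazurTateElement p f (2 * m)).map (algebraMap ℚ ℚ_[p]) : ℚ_[p][X]) :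
      PowerSeries ℚ_[p]) = iwasawaToPowerSeries p (Θ (2 * m) : PowerSeries ℤ_[p]) := by
    rw [← hΘ, Polynomial.polynomial_map_coe]
  have hω : (((-1) ^ (m + 1) * cyclotomicOmegaMinus p (2 * m)).map (Int.castRingHom ℤ_[p]) :
      PowerSeries ℤ_[p]) = (-1) ^ (m + 1) * (Ωm (2 * m) : PowerSeries ℤ_[p]) := by
    rw [Polynomial.map_mul, Polynomial.map_pow, Polynomial.map_neg, Polynomial.map_one,
      Polynomial.coe_mul, Polynomial.coe_pow, Polynomial.coe_neg, Polynomial.coe_one]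
  have hΩ : (((cyclotomicOmega p (2 * m)).map (Int.castRingHom ℤ_[p]) : ℤ_[p][X]) :
      PowerSeries ℤ_[p]) = ((X : ℤ_[p][X]) : PowerSeries ℤ_[p]) * (Ωp (2 * m) : PowerSeries ℤ_[p]) *
        (Ωm (2 * m) : PowerSeries ℤ_[p]) := by
    rw [← X_mul_cyclotomicOmegaPlus_mul_cyclotomicOmegaMinus, Polynomial.map_mul,
      Polynomial.map_mul, Polynomial.map_X, Polynomial.coe_mul, Polynomial.coe_mul]
  have hΘq : (Θ (2 * m) : PowerSeries ℤ_[p]) =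
      (Ωm (2 * m) : PowerSeries ℤ_[p]) * ((Θ (2 * m) /ₘ Ωm (2 * m) : ℤ_[p][X]) : PowerSeries ℤ_[p]) := by
    rw [← Polynomial.coe_mul, mul_divByMonic_eq_of_monic_of_dvd (hmon _) (hdiv m)]
  have hgq : (g m : PowerSeries ℤ_[p]) =
      (-1) ^ (m + 1) * ((Θ (2 * m) /ₘ Ωm (2 * m) : ℤ_[p][X]) : PowerSeries ℤ_[p]) := by
    rw [hg]
    dsimp only
    rw [Polynomial.coe_mul, Polynomial.coe_pow, Polynomial.coe_neg, Polynomial.coe_one]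
  have hσ : ((-1 : PowerSeries ℤ_[p]) ^ (m + 1)) * (-1) ^ (m + 1) = 1 := by
    rw [← mul_pow, neg_one_mul, neg_neg, one_pow]
  have hLQ' : L - (g m : PowerSeries ℤ_[p]) =
      ((X : ℤ_[p][X]) : PowerSeries ℤ_[p]) * (Ωp (2 * m) : PowerSeries ℤ_[p]) * Q := by
    rw [← Polynomial.coe_mul]
    exact hLQ
  have key := sub_mul_eq_of_identities'' hσ hΘq hgq hLQ' hΩ
  rw [pow_zero, map_one, one_mul, hθ, hω, ← map_sub, key]

/-- **EXISTENCE of Kobayashi's PLUS function `L_p⁺(V, η, X)` on the quadratic branch** (Thm. 3.2 with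
(3.4), (3.6); the function `Lη` of (C1_η) `QuadraticBranchPlusMainConjectureAt`): for `p` odd, `f` a
rational newform of level prime to `p` with `a_p(f) = 0` and any `p`-integral `ϖ ∈ ℚ`, there is
`L ∈ Λ` with `IsQuadraticBranchPlusLFunction f p ϖ L` (`L = ϖ·M⁺`, `u = 1`). At `n = 0` (`ψ = η`,
`ζ = 1`, `ω⁻_0 = 1`) the interpolation is `L(0) = −ϖ ∑_{a mod p} η(a)[a/p]^δ_f` (= (3.6)).
[cite: Kobayashi2003, Thm. 3.2, (3.4) and (3.6) (p. 7)] [cite: Pollack2003, Thm. 5.6 and Prop. 6.18] -/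
theorem exists_isQuadraticBranchPlusLFunction (hp2 : p ≠ 2) (hf0 : IsNewform0 f)
    (hQ : coeffField f = ⊥) (hpN : ¬ p ∣ N) (hap : cuspCoeff f p = ((0 : ℤ) : ℂ)) (ϖ : ℚ)
    (hϖ : ‖(ϖ : ℚ_[p])‖ ≤ 1) :
    ∃ L : IwasawaAlgebra p, IsQuadraticBranchPlusLFunction f p ϖ L := by
  have he : cyclotomicExponent p = 1 := if_neg hp2
  obtain ⟨M, hM⟩ := exists_isCongrModOmega_quadraticBranch_even hp2 hf0 hQ hpN hap
  set c : ℤ_[p] := ⟨(ϖ : ℚ_[p]), hϖ⟩ with hc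
  set ι : ℤ_[p] →+* ℂ_[p] := (algebraMap ℚ_[p] ℂ_[p]).comp (algebraMap ℤ_[p] ℚ_[p]) with hι
  have hιc : ι c = algebraMap ℚ_[p] ℂ_[p] (ϖ : ℚ_[p]) := by
    rw [hι, RingHom.comp_apply]
    rfl
  refine ⟨PowerSeries.C c * M, 1, fun n hn ψ hψ ↦ ?_⟩
  have key : ∀ (K : ℕ) (hK : K = n + cyclotomicExponent p)
      (ψ : DirichletCharacter ℂ_[p] (p ^ K)), orderOf ψ = 2 * p ^ n →
      HasSum (fun k : ℕ ↦ ι (PowerSeries.coeff k (PowerSeries.C c * M)) *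
        (ψ (cyclotomicGenerator p : ZMod (p ^ K)) - 1) ^ k)
        ((-1 : ℂ_[p]) ^ (n / 2 + 1) *
          algebraMap ℚ_[p] ℂ_[p] ((((1 : ℤ_[p]ˣ) : ℤ_[p]) : ℚ_[p]) * (ϖ : ℚ_[p])) *
          (if Even (p / 2) then ratTwistedSymbolSum f ψ else ratMinusTwistedSymbolSum f ψ) /
          (cyclotomicOmegaMinus p n).eval₂ (algebraMap ℤ ℂ_[p])
            (ψ (cyclotomicGenerator p : ZMod (p ^ K)) - 1)) := by
    intro K hK ψ hψ
    subst hK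
    obtain ⟨m, rfl⟩ := hn
    set ζ : ℂ_[p] := ψ (cyclotomicGenerator p : ZMod (p ^ (m + m + cyclotomicExponent p)))
      with hζ
    have hordζ := orderOf_apply_cyclotomicGenerator_of_orderOf_eq hp2 ψ hψ
    have hprim : IsPrimitiveRoot ζ (p ^ (m + m)) := hordζ ▸ IsPrimitiveRoot.orderOf ζ
    have hpow : ζ ^ p ^ (m + m) = 1 := hordζ ▸ pow_orderOf_eq_one ζ
    have hz : ‖ζ - 1‖ < 1 := norm_sub_one_lt_one_of_pow_prime_pow_eq_one hpow
    have hzn : (1 + (ζ - 1)) ^ p ^ (m + m) = 1 := by rwa [add_sub_cancel]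
    have hω : (cyclotomicOmegaMinus p (m + m)).eval₂ (algebraMap ℤ ℂ_[p]) (ζ - 1) ≠ 0 :=
      eval₂_cyclotomicOmegaMinus_ne_zero ⟨m, rfl⟩ hprim
    have h1 := (hM m).eval₂_eq hz (by rw [two_mul]; exact hzn)
    rw [two_mul, eval₂_quadraticBranchMazurTateElement_eq f hp2 ψ hψ, eval₂_mul, eval₂_pow,
      eval₂_neg, eval₂_one] at h1
    have hsum : HasSum (fun k ↦ ι (PowerSeries.coeff k M) * (ζ - 1) ^ k)
        (∑' k, ι (PowerSeries.coeff k M) * (ζ - 1) ^ k) :=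
      (summable_map_coeff_mul_pow _ (norm_algebraMap_coeff_le_one M) hz).hasSum
    have hval : ∑' k, ι (PowerSeries.coeff k M) * (ζ - 1) ^ k =
        (-1 : ℂ_[p]) ^ ((m + m) / 2 + 1) *
          (if Even (p / 2) then ratTwistedSymbolSum f ψ else ratMinusTwistedSymbolSum f ψ) /
          (cyclotomicOmegaMinus p (m + m)).eval₂ (algebraMap ℤ ℂ_[p]) (ζ - 1) := by
      rw [show (m + m) / 2 + 1 = m + 1 by omega, eq_div_iff hω, h1, hι]
      have hs : ((-1 : ℂ_[p]) ^ (m + 1)) * (-1) ^ (m + 1) = 1 := by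
        rw [← mul_pow, neg_one_mul, neg_neg, one_pow]
      linear_combination (-((cyclotomicOmegaMinus p (m + m)).eval₂ (algebraMap ℤ ℂ_[p]) (ζ - 1) *
        ∑' k, ι (PowerSeries.coeff k M) * (ζ - 1) ^ k)) * hs
    rw [hval] at hsum
    have h2 := hsum.mul_left (algebraMap ℚ_[p] ℂ_[p] (ϖ : ℚ_[p]))
    have hfun : (fun k : ℕ ↦ ι (PowerSeries.coeff k (PowerSeries.C c * M)) * (ζ - 1) ^ k) =
        fun k ↦ algebraMap ℚ_[p] ℂ_[p] (ϖ : ℚ_[p]) * (ι (PowerSeries.coeff k M) * (ζ - 1) ^ k) := by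
      funext k
      rw [PowerSeries.coeff_C_mul, map_mul, hιc, mul_assoc]
    have hvalue : (-1 : ℂ_[p]) ^ ((m + m) / 2 + 1) *
          algebraMap ℚ_[p] ℂ_[p] ((((1 : ℤ_[p]ˣ) : ℤ_[p]) : ℚ_[p]) * (ϖ : ℚ_[p])) *
          (if Even (p / 2) then ratTwistedSymbolSum f ψ else ratMinusTwistedSymbolSum f ψ) /
          (cyclotomicOmegaMinus p (m + m)).eval₂ (algebraMap ℤ ℂ_[p]) (ζ - 1) =
        algebraMap ℚ_[p] ℂ_[p] (ϖ : ℚ_[p]) * ((-1 : ℂ_[p]) ^ ((m + m) / 2 + 1) *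
          (if Even (p / 2) then ratTwistedSymbolSum f ψ else ratMinusTwistedSymbolSum f ψ) /
          (cyclotomicOmegaMinus p (m + m)).eval₂ (algebraMap ℤ ℂ_[p]) (ζ - 1)) := by
      rw [Units.val_one, PadicInt.coe_one, one_mul]
      ring
    rw [hfun, hvalue]
    exact h2
  exact key (n + 1) (by rw [he]) ψ hψ

end PlusBranch

section PlusCurve

variable {V : WeierstrassCurve ℚ} [V.IsElliptic] [V.IsGloballyMinimal] {N : ℕ} [NeZero N]
  {f : CuspForm (Gamma0 N) 2} {p : ℕ} [hp : Fact p.Prime]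

/-- **`L_p⁺(V, η, X)` EXISTS for the good `a_p = 0` curve `V`** (the `Lη` quantified by (C1_η)
`QuadraticBranchPlusMainConjectureAt V p`, so that conjecture is NOT vacuous): for `p` odd, `f` the
newform of `V`, good reduction at `p`, `a_p(V) = 0`, any `p`-integral `ϖ`.
[cite: Kobayashi2003, Thm. 3.2 and (3.4) (p. 7)] [cite: Pollack2003, Thm. 5.6 and Prop. 6.18] -/
theorem exists_isQuadraticBranchPlusLFunction_of_isNewformOf (hp2 : p ≠ 2) (hf : IsNewformOf V f)
    (hgood : V.HasGoodReductionAtPrime p) (hap : V.frobeniusTrace p = 0) (ϖ : ℚ)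
    (hϖ : ‖(ϖ : ℚ_[p])‖ ≤ 1) :
    ∃ L : IwasawaAlgebra p, IsQuadraticBranchPlusLFunction f p ϖ L := by
  have hap' : cuspCoeff f p = ((0 : ℤ) : ℂ) := by
    rw [cuspCoeff_eq_frobeniusTrace_of_isNewformOf_holds hf hgood, hap]
  exact exists_isQuadraticBranchPlusLFunction hp2 hf.1 hf.coeffField_eq_bot
    (not_dvd_level_of_isNewformOf hf hgood) hap' ϖ hϖ

end PlusCurve

end Summit.BirchSwinnertonDyer.Rank1Residual.Additive

end
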